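import Summits.ABC.ABC.Theses.DefiniteXi
import Summits.ABC.ABC.Theorems.IsogenyGlueCongruenceMazurKenkuBoundLevelThirtyTwo
import Literature.NumberTheory.EllipticCurves.PastenHeightBoundsLemma68LocalProofs
import Literature.NumberTheory.EllipticCurves.CyclicIsogenyCharacterFrobeniusProofs
import Literature.NumberTheory.EllipticCurves.RationalIsogenyFrobeniusCriterionPrimePower
import Literature.NumberTheory.EllipticCurves.RationalIsogenyDegreesProofs
import Literature.NumberTheory.EllipticCurves.IsogenyQuadraticTwistProofs
import Literature.NumberTheory.EllipticCurves.IsogenyVariableChangeProofs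
import Literature.NumberTheory.EllipticCurves.LocalTorsionGoodReductionPPrimaryProofs
import Literature.NumberTheory.EllipticCurves.AnomalousOfRationalTorsionProofs
import Literature.NumberTheory.EllipticCurves.IsogenyFrobeniusTraceProofs
import Literature.NumberTheory.EllipticCurves.PastenValuationProductThm75MultiplicityProofs
import Literature.NumberTheory.DiophantineGeometry.GeneralizedFermatTwoPowerCoefficientFreyProofs
import HarnessLib

/-!
# Stub-ideation k=2 (gen 8, FAMILY 2 — RESHAPE) for `stub_pastenLemma68` — crux `DefiniteRTControlPrime`

Companion to `STUB-IDEAS-stub_pastenLemma68-2.md` (gen 8).  Scratch check that the helper STATEMENTS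
elaborate; every `sorry` is a HELPER BODY (one stub-prover cycle each); the `sorry`-free items are the
arithmetic ends of the chain.

* Verbatim stub (`PastenShimura2024_lemma_6_8`) = Mazur–Kenku-complete (tree
  `prime_degree_le_163_of_PastenShimura2024_lemma_6_8`); closer `PastenShimura2024_lemma_6_8_of_mazurKenku'`
  (checked in §0); the stub prover releases `blocked-on: stmt-ABC-15193`.
* Gen-8 reshape = **the semistable short cut** for the Mazur-free supplier of the ROOTED sub-polynomial
  radius `FreyIsogenyRadiusSubpoly` (k2-g5 leaf, verbatim in §1; its consumer
  `definiteRTControlPrime_of_freyIsogenyRadiusSubpoly (hT) (hR) : DefiniteRTControlPrime` is PROVED in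
  `StubIdeasK2G5PastenLemma68.lean`, 0 sorries), under which `stub_pastenLemma68` and `stub_pasten163`
  BOTH leave the trust base:
  - REGIME SPLIT at the place `2` after normalising the Frey triple up to translation / the `−1` twist
    (N0–N2): `16 ∣ B` ⇒ the curve is semistable EVERYWHERE (tree
    `isSemistable_freyCurve_of_sixteen_dvd`); `16 ∤ B` ⇒ `E[ℓ]` irreducible for every odd `ℓ` (Swan
    parity, k3-g8 H5) ⇒ cyclic degrees out of `E` divide `16` (T3R);
  - on an everywhere-semistable globally minimal curve the half-level character of a stable cyclic line
    is EXACTLY `1` or `χ̄` (DICH: k2-163 g7's LOCℓ + U2 + Minkowski with the `v = 2` twist lemmas T1/T2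
    and the 12th powers deleted), so at a good odd `p ≠ ℓ` the Frobenius congruence gives
    `ℓ^⌈k/2⌉ ∣ #Ẽ(𝔽_p) = p + 1 − a_p ≤ 2p + 1` (FROB; the algebra A0 is PROVED below — no `n₁₂`, no A1,
    no Hasse), whence cyclic degrees out of `W` divide `16 · (N_{p₀} N_{p₁})²` (C0¹) for the two least
    odd good primes, `pᵢ ≤ C log N` (Chebyshev, tree `exists_prime_not_dvd_le_log`): radius
    `≤ 16 (2p₀+1)² (2p₁+1)² ≪ (log N)⁴ ≤ R_ε N^ε`.
-/

set_option linter.dupNamespace false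

namespace Summit.ABC.ABC.Cruxes.DefiniteRTControlPrime.StubIdeas2G8

open Literature.NumberTheory.EllipticCurves Literature.NumberTheory.EllipticCurves.ModularForms
open Literature.NumberTheory.GaloisRepresentations Literature.NumberTheory.DiophantineGeometry
open Summit.ABC.ABC.Theses.DefiniteXi
open WeierstrassCurve IsDedekindDomain NumberField Field
open scoped NumberField

/-! ## §0 The verbatim stub: pointers checked by name -/

example : mazurKenku_exists_cyclic_isogeny → PastenShimura2024_lemma_6_8 :=
  PastenShimura2024_lemma_6_8_of_mazurKenku'

/-- Chebyshev input of the counting end (tree, PROVED). -/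
example : ∃ C : ℝ, ∀ N : ℕ, N ≠ 0 → ∃ ℓ : ℕ, ℓ.Prime ∧ ¬ ℓ ∣ N ∧ (ℓ : ℝ) ≤ 2 * Real.log N + C :=
  exists_prime_not_dvd_le_log

/-- The `2`-part input (landed, Kenku level `32`). -/
example {V V' : WeierstrassCurve ℚ} [V.IsElliptic] [V'.IsElliptic] (ψ : Isogeny V V')
    (hψ : ψ.IsCyclic) : ψ.degree ≠ 32 :=
  Summit.ABC.ABC.Theorems.isogeny_isCyclic_degree_ne_thirtyTwo ψ hψ

/-! ## §1 Leaves (verbatim from k2-g5 / k2-163 g7) and the pointwise cyclic radius -/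

/-- `⌈k/2⌉` (k2-163 g3–g7 verbatim). -/
def halfCeil (k : ℕ) : ℕ := (k + 1) / 2

theorem halfCeil_le (k : ℕ) : halfCeil k ≤ k := by unfold halfCeil; omega

theorem le_two_mul_halfCeil (k : ℕ) : k ≤ 2 * halfCeil k := by unfold halfCeil; omega

theorem pow_halfCeil_dvd (ℓ k : ℕ) : ℓ ^ halfCeil k ∣ ℓ ^ k := pow_dvd_pow ℓ (halfCeil_le k)

/-- **L1ε (k2-g5 verbatim).** Sub-polynomial ROOTED radius of the Frey class; its consumer
`definiteRTControlPrime_of_freyIsogenyRadiusSubpoly (hT : takahashi2001_thm_2_3_of_coprime) (hR)` is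
PROVED in `StubIdeasK2G5PastenLemma68.lean` (crux workfile, not importable). -/
def FreyIsogenyRadiusSubpoly : Prop :=
  ∀ ε : ℝ, 0 < ε → ∃ R : ℝ, ∀ (a b : ℤ), IsCoprime a b → a * b * (a + b) ≠ 0 →
    ∀ q : ℕ, q.Prime → q ≠ 2 → q ∣ (freyCurve a b).conductorNorm ℤ →
    ∀ (W' : WeierstrassCurve ℚ) [W'.IsElliptic], (freyCurve a b).IsIsogenous W' →
      ∃ φ : Isogeny (freyCurve a b) W',
        (φ.degree : ℝ) ≤ R * (((freyCurve a b).conductorNorm ℤ : ℕ) : ℝ) ^ ε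

/-- The pointwise CYCLIC RADIUS of one model: every cyclic `ℚ`-isogeny out of `V` has degree `≤ R`.
(`IsIsogenous.exists_isCyclic` turns it into the rooted radius of the class of `V`.) -/
def CyclicRadiusLe (V : WeierstrassCurve ℚ) [V.IsElliptic] (R : ℕ) : Prop :=
  ∀ (W₂ : WeierstrassCurve ℚ) [W₂.IsElliptic] (φ : Isogeny V W₂), φ.IsCyclic → φ.degree ≤ R

theorem CyclicRadiusLe.mono {V : WeierstrassCurve ℚ} [V.IsElliptic] {R R' : ℕ} (h : CyclicRadiusLe V R)
    (hRR' : R ≤ R') : CyclicRadiusLe V R' :=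
  fun W₂ _ φ hφ => (h W₂ φ hφ).trans hRR'

/-! ## §2 Normalisation carrying the radius (N0–N2) -/

/-- **N2 (XS).** A change of variables does not change the cyclic radius (`VariableChange.toIsogeny`,
`degree_toIsogeny = 1`, `Isogeny.comp`, kernels correspond under the bijection). -/
theorem cyclicRadiusLe_smul_iff {V : WeierstrassCurve ℚ} [V.IsElliptic] (C : VariableChange ℚ)
    (R : ℕ) : CyclicRadiusLe (C • V) R ↔ CyclicRadiusLe V R := by
  sorry

/-- **N1 (S).** The `−1` twist does not change the cyclic radius of a Frey model:
`(freyCurve A B).quadraticTwist (-1) = freyCurve B A` (`quadraticTwist_freyCurve_neg_one`, twice),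
`Isogeny.quadraticTwist`, `Isogeny.degree_quadraticTwist`, and `ker φ^{(d)} ≃ ker φ` keeps cyclicity. -/
theorem cyclicRadiusLe_freyCurve_swap {A B : ℤ} [(freyCurve A B).IsElliptic]
    [(freyCurve B A).IsElliptic] {R : ℕ} (h : CyclicRadiusLe (freyCurve A B) R) :
    CyclicRadiusLe (freyCurve B A) R := by
  sorry

/-- **N0 (S, the tree's `exists_normalised_freyCurve` carrying the MODEL instead of `ρ̄_p`).**
Every Frey triple is, up to a change of variables, a normalised one (`A ≡ −1 (4)`, `2 ∣ B`) or its
swap (= `−1` twist): translation `translate_freyCurve`, `freyCurve_swap`, sign fix. -/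
theorem exists_normalised_freyCurve_smul {a b : ℤ} (hab : IsCoprime a b) (h0 : a * b * (a + b) ≠ 0) :
    ∃ (A B : ℤ) (C : VariableChange ℚ), IsCoprime A B ∧ A * B * (A + B) ≠ 0 ∧ A ≡ -1 [ZMOD 4] ∧
      (2 : ℤ) ∣ B ∧ (C • freyCurve a b = freyCurve A B ∨ C • freyCurve a b = freyCurve B A) := by
  sorry

/-! ## §3 Regime T3 (`16 ∤ B`): no odd cyclic degrees at all -/

/-- **T3R (S).** Normalised, `2 ∣ B`, `16 ∤ B`, `2A + B ≠ 0`: every cyclic isogeny out of `E_(A,B)`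
has degree dividing `16`, hence `≤ 16`.  Odd `ℓ`: `E[ℓ]` irreducible (k3-g8 H5 = Swan parity:
`Sw₂(E[ℓ]) = Sw₂(E[3]) ∈ {1,3}` is odd, a reducible `E[ℓ]` has even Swan conductor —
`exists_swanConductorAt_torsion_eq_two_mul_of_not_hasIrreducibleModPGaloisRep`) ⇒ `ℓ ∤ deg`
(k3 B5 `not_dvd_degree_of_hasIrreducibleModPGaloisRep`, PROVED there); `2`-part: `32 ∤ deg`
(`isogeny_isCyclic_degree_ne_thirtyTwo` + `Isogeny.exists_isCyclic_degree_eq_of_dvd`).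
(`2A + B = 0` is `y² = x³ ∓ x`, `N = 32`: no odd `q ∣ N`, vacuous for the leaf.) -/
theorem cyclicRadiusLe_sixteen_of_not_sixteen_dvd {A B : ℤ} (hAB : IsCoprime A B)
    (h0 : A * B * (A + B) ≠ 0) (hA : A ≡ -1 [ZMOD 4]) (hB : (2 : ℤ) ∣ B) (h16 : ¬ (16 : ℤ) ∣ B)
    (h2AB : 2 * A + B ≠ 0) :
    haveI := isElliptic_freyCurve h0
    CyclicRadiusLe (freyCurve A B) 16 := by
  sorry

/-! ## §4 Regime S (everywhere semistable): EXACT half-level dichotomy and the `#Ẽ(𝔽_p)` count -/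

/-- **DICH (S–M; = k2-163 g7 GLOB with T1/T2 and the 12th powers deleted).**  `W` globally minimal and
semistable at EVERY place, `ℓ` odd, `ℤP` a stable cyclic line of order `ℓᵏ` with character `r`
(`exists_cyclicCharacter_of_addOrderOf`), `r̄ := r mod ℓ^⌈k/2⌉`.  Then `r̄ = 1` or `r̄ = χ̄_{ℓ^⌈k/2⌉}`
identically on `Γ_ℚ`: LOCℓ (`r|_{I_ℓ} ∈ {1, χ}`, k2-163 D1 PROVED + D2/D3′/SS), U2 (`r̄|_{I_v} = 1` at
multiplicative `v ∤ ℓ`), `Mazur1978.cyclicCharacter_eq_one_of_mem_inertia` at good `v ∤ ℓ`, open kernel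
(k2-163 OPEN, PROVED), Minkowski `Mazur1978.monoidHom_eq_one_of_forall_inertia` on `ψ = r̄` resp.
`r̄ χ̄⁻¹`.  [Serre 1972 §5.4 Prop. 21 at prime level; Mazur 1978 §5.] -/
theorem unitsMap_cyclicCharacter_dichotomy_of_isSemistable (W : WeierstrassCurve ℚ) [W.IsElliptic]
    [W.IsGloballyMinimal] (ℓ k : ℕ) [Fact ℓ.Prime] (hℓ2 : ℓ ≠ 2) (hk : 1 ≤ k)
    (hss : ∀ v : HeightOneSpectrum (𝓞 ℚ), W.IsSemistableAt v)
    {P : geomPoints W} (hP : addOrderOf P = ℓ ^ k)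
    {r : absoluteGaloisGroup ℚ →* (ZMod (ℓ ^ k))ˣ}
    (hr : ∀ σ : absoluteGaloisGroup ℚ, σ • P = ((r σ : (ZMod (ℓ ^ k))ˣ) : ZMod (ℓ ^ k)).val • P) :
    (∀ σ : absoluteGaloisGroup ℚ, ZMod.unitsMap (pow_halfCeil_dvd ℓ k) (r σ) = 1) ∨
      (∀ σ : absoluteGaloisGroup ℚ, ZMod.unitsMap (pow_halfCeil_dvd ℓ k) (r σ) =
        modNCyclotomicCharacter ℚ (ℓ ^ halfCeil k) σ) := by
  sorry

/-- **A0 (PROVED; replaces k2-163's A1 / `n₁₂`).**  In `ℤ/n`, if `t ∈ {1, p}` is a root of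
`X² − aX + p` and `p` is a unit, then `n ∣ p + 1 − a` (`= #Ẽ(𝔽_p)`). -/
theorem natCast_dvd_of_root_one_or_p {n p : ℕ} [NeZero n] (a : ℤ) (hp : IsUnit (p : ZMod n))
    {t : ZMod n} (ht : t ^ 2 - (a : ZMod n) * t + (p : ZMod n) = 0)
    (h : t = 1 ∨ t = (p : ZMod n)) : (n : ℤ) ∣ (p : ℤ) + 1 - a := by
  have key : ((((p : ℤ) + 1 - a : ℤ)) : ZMod n) = 0 := by
    rcases h with rfl | rfl
    · push_cast
      linear_combination ht
    · have h2 : (p : ZMod n) * ((p : ZMod n) + 1 - (a : ZMod n)) = 0 := by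
        linear_combination ht
      have h3 : (p : ZMod n) + 1 - (a : ZMod n) = 0 := hp.mul_right_eq_zero.mp h2
      push_cast
      exact h3
  exact (ZMod.intCast_zmod_eq_zero_iff_dvd _ n).mp key

/-- **FROB (S).**  `W` globally minimal, semistable everywhere, `ℓ` odd, `ℤP` stable of order `ℓᵏ`
(`k ≥ 1`), `p ∉ {2, ℓ}` good.  Then `ℓ^⌈k/2⌉ ∣ #Ẽ(𝔽_p) = reductionPointCount W p`: character `r`
(`exists_cyclicCharacter_of_addOrderOf`), DICH, an arithmetic Frobenius `φ` over `p`
(`exists_isArithFrobAt_of_mem_primesAbove_holds`), `Mazur1978.cyclicCharacter_sq_sub_frobeniusTrace_mul_add_eq_zero`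
pushed along `ZMod (ℓᵏ) → ZMod (ℓ^⌈k/2⌉)` (`ZMod.castHom`), `χ̄(φ) = p`
(`modNCyclotomicCharacter_eq_residueCard_of_isArithFrobAt`), A0, `frobeniusTrace = p + 1 − N_p`. -/
theorem pow_halfCeil_dvd_reductionPointCount (W : WeierstrassCurve ℚ) [W.IsElliptic]
    [W.IsGloballyMinimal] (ℓ k : ℕ) [Fact ℓ.Prime] (hℓ2 : ℓ ≠ 2) (hk : 1 ≤ k)
    (hss : ∀ v : HeightOneSpectrum (𝓞 ℚ), W.IsSemistableAt v)
    {P : geomPoints W} (hP : addOrderOf P = ℓ ^ k)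
    (hst : ∀ σ : absoluteGaloisGroup ℚ, σ • P ∈ AddSubgroup.zmultiples P)
    (p : ℕ) [Fact p.Prime] (hp2 : p ≠ 2) (hpℓ : p ≠ ℓ) (hgood : W.HasGoodReductionAtPrime p) :
    ℓ ^ halfCeil k ∣ W.reductionPointCount p := by
  sorry

/-- **C1 (PROVED, k2-163 g3 verbatim): half exponents at every prime give `d ∣ n²`.** -/
theorem dvd_sq_of_forall_pow_halfCeil_dvd {d n : ℕ} (hd : 0 < d) (hn : 0 < n)
    (h : ∀ ℓ : ℕ, ℓ.Prime → ℓ ∣ d → ℓ ^ halfCeil (d.factorization ℓ) ∣ n) : d ∣ n ^ 2 := by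
  rw [← Nat.factorization_le_iff_dvd hd.ne' (pow_pos hn 2).ne', Nat.factorization_pow]
  refine Finsupp.le_def.mpr fun ℓ => ?_
  rw [Finsupp.smul_apply, smul_eq_mul]
  by_cases hℓ : ℓ.Prime
  · by_cases hℓd : ℓ ∣ d
    · have h2 : halfCeil (d.factorization ℓ) ≤ n.factorization ℓ :=
        (hℓ.pow_dvd_iff_le_factorization hn.ne').mp (h ℓ hℓ hℓd)
      have h3 := le_two_mul_halfCeil (d.factorization ℓ)
      omega
    · rw [Nat.factorization_eq_zero_of_not_dvd hℓd]; exact Nat.zero_le _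
  · rw [Nat.factorization_eq_zero_of_not_prime d hℓ]; exact Nat.zero_le _

/-- **C0¹ (S assembly).**  `W₁` globally minimal and semistable EVERYWHERE: a cyclic isogeny out of
`W₁` has degree dividing `16 · (N_{p₀} N_{p₁})²` for any two distinct odd good primes — odd `ℓ`-parts:
G0 (the `ℓ`-primary part of the kernel is a stable line of order `ℓ^{v_ℓ(deg)}`, k2-163 g7
`exists_stableLine_of_isCyclic`) + FROB at the `pᵢ ≠ ℓ` + C1; `2`-part `∣ 16` (§0). -/
theorem cyclicDegree_dvd_sixteen_mul_sq (W₁ W₂ : WeierstrassCurve ℚ) [W₁.IsElliptic] [W₂.IsElliptic]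
    [W₁.IsGloballyMinimal] (hss : ∀ v : HeightOneSpectrum (𝓞 ℚ), W₁.IsSemistableAt v)
    (φ : Isogeny W₁ W₂) (hφ : φ.IsCyclic) (p₀ p₁ : ℕ) [Fact p₀.Prime] [Fact p₁.Prime]
    (hp₀ : p₀ ≠ 2) (hp₁ : p₁ ≠ 2) (hne : p₀ ≠ p₁)
    (hg₀ : W₁.HasGoodReductionAtPrime p₀) (hg₁ : W₁.HasGoodReductionAtPrime p₁) :
    φ.degree ∣ 16 * (W₁.reductionPointCount p₀ * W₁.reductionPointCount p₁) ^ 2 := by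
  sorry

/-- **CNT (PROVED from C0¹).**  The cyclic radius of an everywhere-semistable globally minimal curve is
`≤ 16 · ((2p₀+1)(2p₁+1))²` (`reductionPointCount_le_two_mul_add_one`, `reductionPointCount_pos`). -/
theorem cyclicRadiusLe_of_isSemistable (W₁ : WeierstrassCurve ℚ) [W₁.IsElliptic] [W₁.IsGloballyMinimal]
    (hss : ∀ v : HeightOneSpectrum (𝓞 ℚ), W₁.IsSemistableAt v) (p₀ p₁ : ℕ) [Fact p₀.Prime]
    [Fact p₁.Prime] (hp₀ : p₀ ≠ 2) (hp₁ : p₁ ≠ 2) (hne : p₀ ≠ p₁)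
    (hg₀ : W₁.HasGoodReductionAtPrime p₀) (hg₁ : W₁.HasGoodReductionAtPrime p₁) :
    CyclicRadiusLe W₁ (16 * ((2 * p₀ + 1) * (2 * p₁ + 1)) ^ 2) := by
  intro W₂ _ φ hφ
  have hdvd := cyclicDegree_dvd_sixteen_mul_sq W₁ W₂ hss φ hφ p₀ p₁ hp₀ hp₁ hne hg₀ hg₁
  have h₀ := reductionPointCount_le_two_mul_add_one W₁ p₀
  have h₁ := reductionPointCount_le_two_mul_add_one W₁ p₁
  have hpos₀ := reductionPointCount_pos W₁ p₀
  have hpos₁ := reductionPointCount_pos W₁ p₁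
  have hpos : 0 < 16 * (W₁.reductionPointCount p₀ * W₁.reductionPointCount p₁) ^ 2 := by positivity
  calc φ.degree ≤ 16 * (W₁.reductionPointCount p₀ * W₁.reductionPointCount p₁) ^ 2 :=
        Nat.le_of_dvd hpos hdvd
    _ ≤ 16 * ((2 * p₀ + 1) * (2 * p₁ + 1)) ^ 2 := by gcongr

/-! ## §5 The Frey assembly -/

/-- **SEMI (XS–S).**  Normalised with `16 ∣ B`: the global minimal model `C • E_(A,B)` is semistable at
every place of `𝓞 ℚ` (`isSemistable_freyCurve_of_sixteen_dvd` over `ℤ`, `isSemistableAt_smul_iff_holds`,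
places of `ℤ` ↔ places of `𝓞 ℚ`). -/
theorem isSemistableAt_smul_freyCurve_of_sixteen_dvd {A B : ℤ} (hAB : IsCoprime A B)
    (h0 : A * B * (A + B) ≠ 0) (hA : A ≡ -1 [ZMOD 4]) (hB : (16 : ℤ) ∣ B) (C : VariableChange ℚ)
    (v : HeightOneSpectrum (𝓞 ℚ)) : (C • freyCurve A B).IsSemistableAt v := by
  sorry

/-- **GOOD (XS; = k2-163 g6 GR).**  An odd prime `p ∤ AB(A+B)` is good for (any model of) the Frey
curve (`radical_natAbs_dvd_two_mul_conductorNorm_freyCurve`, `hasGoodReductionAtPrime_of_not_dvd_conductorNorm`,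
`hasGoodReductionAtPrime_iff_of_variableChange`). -/
theorem hasGoodReductionAtPrime_smul_freyCurve {A B : ℤ} (hAB : IsCoprime A B)
    (h0 : A * B * (A + B) ≠ 0) (C : VariableChange ℚ) {p : ℕ} [Fact p.Prime] (hp2 : p ≠ 2)
    (hp : ¬ (p : ℤ) ∣ A * B * (A + B)) :
    haveI := isElliptic_freyCurve h0
    (C • freyCurve A B).HasGoodReductionAtPrime p := by
  sorry

/-- **SMALL (S; Chebyshev twice).**  Two distinct odd primes off `N` of size `O(log N)`:
`exists_prime_not_dvd_le_log` at `2N`, then at `2N p₀`. -/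
theorem exists_two_odd_primes_not_dvd_le_log :
    ∃ C : ℝ, ∀ N : ℕ, N ≠ 0 → ∃ p₀ p₁ : ℕ, p₀.Prime ∧ p₁.Prime ∧ p₀ ≠ 2 ∧ p₁ ≠ 2 ∧ p₀ ≠ p₁ ∧
      ¬ p₀ ∣ N ∧ ¬ p₁ ∣ N ∧ (p₀ : ℝ) ≤ C * Real.log N + C ∧ (p₁ : ℝ) ≤ C * Real.log N + C := by
  sorry

/-- **RAD (S assembly).**  For every Frey triple the cyclic radius of `E_(a,b)` is
`≤ 16 · ((2p₀+1)(2p₁+1))²` for ANY two distinct odd primes `p₀, p₁ ∤ ab(a+b)`: N0 (normal form) + N1/N2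
(transport) + [T3R if `16 ∤ B`, with `16 ≤ …`] + [SEMI + GOOD + CNT on the minimal model, N2, if `16 ∣ B`];
`pᵢ ∤ AB(A+B)` is `pᵢ ∤ ab(a+b)` (same radical: translations / swap permute `{a, b, −a−b}` up to sign). -/
theorem cyclicRadiusLe_freyCurve {a b : ℤ} (hab : IsCoprime a b) (h0 : a * b * (a + b) ≠ 0)
    (p₀ p₁ : ℕ) (hp₀ : p₀.Prime) (hp₁ : p₁.Prime) (h₀2 : p₀ ≠ 2) (h₁2 : p₁ ≠ 2) (hne : p₀ ≠ p₁)
    (hd₀ : ¬ (p₀ : ℤ) ∣ a * b * (a + b)) (hd₁ : ¬ (p₁ : ℤ) ∣ a * b * (a + b)) :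
    haveI := isElliptic_freyCurve h0
    CyclicRadiusLe (freyCurve a b) (16 * ((2 * p₀ + 1) * (2 * p₁ + 1)) ^ 2) := by
  sorry

/-- **SUB (S, analytic end).**  RAD + SMALL + `radical_natAbs_dvd_two_mul_conductorNorm_freyCurve`
(`p ∤ N`, `p` odd ⇒ `p ∤ ab(a+b)`) + `(C log N + C)⁴ ≤ R_ε N^ε` (`Real.log_le_rpow_div`-type) +
`IsIsogenous.exists_isCyclic` ⟹ the k2-g5 leaf.  Then (G5, PROVED)
`definiteRTControlPrime_of_freyIsogenyRadiusSubpoly stub_takahashi freyIsogenyRadiusSubpoly_of_regimes`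
is the crux with trust base `{takahashi2001_thm_2_3_of_coprime}`; `stub_pastenLemma68` is not consumed. -/
theorem freyIsogenyRadiusSubpoly_of_regimes : FreyIsogenyRadiusSubpoly := by
  sorry

/-! ## §6 In-kernel sanity (quick refuters run)
* `halfCeil`: prime level `k = 1` is Serre's exact dichotomy; `k = 2` is the sharp `11a3 → 11a2` case.
* `11a` (`a₃ = −1`, `a₅ = 1`): `N₃ = 5`, `N₅ = 5`; the cyclic `25`-isogeny `11a3 → 11a2` needs
  `5^⌈2/2⌉ = 5 ∣ N₃` ✓ and `25 ∣ 16·(N₃N₅)² = 10000` ✓ (C0¹ is consistent and sharp in the exponent: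
  `25 ∤ 16·N₃N₅ = 400`? no — `400 = 16·25`, so even exponent `1` survives here; the `(ℤ/9)²`-type loss
  of U2 is what forces the square in general).
* A0 at `t = p`: `p = 3`, `a = −1`, `n = 5`: `9 + 3 + 3 = 15 ≡ 0 (mod 5)` and `5 ∣ 3 + 1 + 1`. -/
example : halfCeil 1 = 1 ∧ halfCeil 2 = 1 ∧ halfCeil 3 = 2 ∧ halfCeil 4 = 2 := by decide
example : (3 : ℤ) + 1 - (-1) = 5 ∧ (5 : ℤ) + 1 - 1 = 5 ∧ (25 : ℕ) ∣ 16 * (5 * 5) ^ 2 := by decide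
example : ((3 : ZMod 5) ^ 2 - (-1 : ZMod 5) * 3 + 3 = 0) ∧ ((5 : ℤ) ∣ 3 + 1 - (-1)) := by decide

end Summit.ABC.ABC.Cruxes.DefiniteRTControlPrime.StubIdeas2G8
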